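import Mathlib.MeasureTheory.Constructions.BorelSpace.Order
import Literature.LinearAlgebra.Matrix.HermitianEigenvaluePerturbation

/-!
# Window counts of a Lipschitz Hermitian family (support for stub `stub_coareaPointwise`)
(line `hermitian-flow-coarea`, crux `Summit.QuantumFields.QCD.Theses.SpectralDefectExtinction.TipPricing`,
item stmt-QuantumFields-8967)

Finite-dimensional spectral analysis, Mathlib only (plus the Literature Parseval identity
`inner_eigenvectorBasis_sub_smul`), for a family `t ↦ H(t)` of Hermitian matrices with
`‖(H(t') − H(t))x‖ ≤ |t' − t| ‖x‖` (the Hermitian Wilson flow `Γ₅ (D_W − t)` is the user):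

* `coareaPt_card_window_le` — **Weyl's inequality in window-counting form**: if `‖(B − A)x‖ ≤ δ‖x‖`
  then `#{λ(A) ∈ (a+δ, b−δ)} ≤ #{λ(B) ∈ (a, b)}` (dimension count: a unit vector in the spectral
  subspace of `A` for `(a+δ, b−δ)` orthogonal to the `(a,b)`-eigenvectors of `B` would have
  `‖(B − c)x‖ ≥ ρ` and `< ρ` at once, `c = (a+b)/2`, `ρ = (b−a)/2`);
* `coareaPt_card_zero_le` — the `g` zero modes of `H(t₀)` give `g` eigenvalues of `H(t)` in `(−ε, ε)`
  for `|t − t₀| < ε`;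
* `coareaPt_eventually_card_le`, `coareaPt_measurable_card` — the window count
  `t ↦ #{|λ(H t)| < ε}` is lower semicontinuous, hence Borel measurable;
* `coareaPt_card_small_le`, `coareaPt_det_lower` — near a crossing only the zero-mode branches are
  small, so `|det H(t)| ≥ ε^g (min 1 γ/2)^n` if NO eigenvalue of `H(t)` lies in `(−ε, ε)`;
* `coareaPt_root_window` — consequently, if `|det H(t)| ≤ C|t − t₀|^k` with `k > g` (a defective real
  eigenvalue of algebraic multiplicity `k`), some eigenvalue of `H(t)` lies in `(−ε, ε)` on the window
  `|t − t₀| < kε` for all small `ε`; if `k = g`, `g` eigenvalues do on `|t − t₀| < ε`.  Either way the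
  window count integrates to at least `2εk` around `t₀`.

Reference for the mathematics: T. Kato, *Perturbation Theory for Linear Operators*, Ch. II §5–6
(eigenvalues of a Lipschitz symmetric family are Lipschitz); Horn–Johnson, *Matrix Analysis*, §4.3.
-/

noncomputable section

namespace Summit.QuantumFields.QCD.Cruxes.TipPricing.HermitianFlowCoarea

open Matrix WithLp Filter Topology
open scoped InnerProductSpace
open Literature.LinearAlgebra.Matrix

variable {𝕜 : Type*} [RCLike 𝕜] {n : Type*} [Fintype n] [DecidableEq n]

/-- Parseval for `Hx - μx` in the eigenbasis: `‖Hx - μx‖² = Σ_k (λ_k - μ)² ‖⟪u_k, x⟫‖²`. -/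
theorem coareaPt_norm_sub_smul_sq {H : Matrix n n 𝕜} (hH : H.IsHermitian) (μ : ℝ)
    (x : EuclideanSpace 𝕜 n) :
    ‖toEuclideanLin H x - (μ : 𝕜) • x‖ ^ 2 =
      ∑ k, (hH.eigenvalues k - μ) ^ 2 * ‖⟪hH.eigenvectorBasis k, x⟫_𝕜‖ ^ 2 := by
  rw [← hH.eigenvectorBasis.sum_sq_norm_inner_right]
  refine Finset.sum_congr rfl fun k _ => ?_
  rw [inner_eigenvectorBasis_sub_smul hH μ x k, norm_mul, mul_pow, RCLike.norm_ofReal, sq_abs]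

/-- Lower bound on a spectral subspace: if `m ≤ |λ_k - μ|` for every `k` with `⟪u_k, x⟫ ≠ 0`, then
`m‖x‖ ≤ ‖Hx - μx‖`. -/
theorem coareaPt_mul_norm_le {H : Matrix n n 𝕜} (hH : H.IsHermitian) (μ : ℝ)
    (x : EuclideanSpace 𝕜 n) {m : ℝ} (hm0 : 0 ≤ m)
    (hm : ∀ k, ⟪hH.eigenvectorBasis k, x⟫_𝕜 ≠ 0 → m ≤ |hH.eigenvalues k - μ|) :
    m * ‖x‖ ≤ ‖toEuclideanLin H x - (μ : 𝕜) • x‖ := by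
  have hsq : (m * ‖x‖) ^ 2 ≤ ‖toEuclideanLin H x - (μ : 𝕜) • x‖ ^ 2 := by
    rw [coareaPt_norm_sub_smul_sq hH μ x, mul_pow, ← hH.eigenvectorBasis.sum_sq_norm_inner_right x,
      Finset.mul_sum]
    refine Finset.sum_le_sum fun k _ => ?_
    by_cases hk : ⟪hH.eigenvectorBasis k, x⟫_𝕜 = 0
    · rw [hk, norm_zero]; simp
    · refine mul_le_mul_of_nonneg_right ?_ (sq_nonneg _)
      rw [← sq_abs (hH.eigenvalues k - μ)]
      exact pow_le_pow_left₀ hm0 (hm k hk) 2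
  exact (pow_le_pow_iff_left₀ (mul_nonneg hm0 (norm_nonneg _)) (norm_nonneg _) two_ne_zero).1 hsq

/-- Upper bound on a spectral subspace: if `|λ_k - μ| ≤ M` for every `k` with `⟪u_k, x⟫ ≠ 0`, then
`‖Hx - μx‖ ≤ M‖x‖`. -/
theorem coareaPt_norm_le_mul {H : Matrix n n 𝕜} (hH : H.IsHermitian) (μ : ℝ)
    (x : EuclideanSpace 𝕜 n) {M : ℝ} (hM0 : 0 ≤ M)
    (hM : ∀ k, ⟪hH.eigenvectorBasis k, x⟫_𝕜 ≠ 0 → |hH.eigenvalues k - μ| ≤ M) :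
    ‖toEuclideanLin H x - (μ : 𝕜) • x‖ ≤ M * ‖x‖ := by
  have hsq : ‖toEuclideanLin H x - (μ : 𝕜) • x‖ ^ 2 ≤ (M * ‖x‖) ^ 2 := by
    rw [coareaPt_norm_sub_smul_sq hH μ x, mul_pow, ← hH.eigenvectorBasis.sum_sq_norm_inner_right x,
      Finset.mul_sum]
    refine Finset.sum_le_sum fun k _ => ?_
    by_cases hk : ⟪hH.eigenvectorBasis k, x⟫_𝕜 = 0
    · rw [hk, norm_zero]; simp
    · refine mul_le_mul_of_nonneg_right ?_ (sq_nonneg _)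
      rw [← sq_abs (hH.eigenvalues k - μ)]
      exact pow_le_pow_left₀ (abs_nonneg _) (hM k hk) 2
  exact (pow_le_pow_iff_left₀ (norm_nonneg _) (mul_nonneg hM0 (norm_nonneg _)) two_ne_zero).1 hsq

/-- **Weyl's inequality in window-counting form.** If `‖(B - A)x‖ ≤ δ‖x‖` for Hermitian `A`, `B`,
then `B` has at least as many eigenvalues in `(a, b)` as `A` has in `(a + δ, b - δ)`. -/
theorem coareaPt_card_window_le {A B : Matrix n n 𝕜} (hA : A.IsHermitian) (hB : B.IsHermitian)
    {δ : ℝ} (hδ : 0 ≤ δ) (a b : ℝ)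
    (hAB : ∀ x : EuclideanSpace 𝕜 n, ‖toEuclideanLin B x - toEuclideanLin A x‖ ≤ δ * ‖x‖) :
    (Finset.univ.filter fun i => a + δ < hA.eigenvalues i ∧ hA.eigenvalues i < b - δ).card ≤
      (Finset.univ.filter fun j => a < hB.eigenvalues j ∧ hB.eigenvalues j < b).card := by
  by_contra hlt
  push Not at hlt
  set IA := Finset.univ.filter fun i => a + δ < hA.eigenvalues i ∧ hA.eigenvalues i < b - δ with hIA
  set JB := Finset.univ.filter fun j => a < hB.eigenvalues j ∧ hB.eigenvalues j < b with hJB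
  -- the comparison map
  let Φ : EuclideanSpace 𝕜 n →ₗ[𝕜] ({i // i ∉ IA} → 𝕜) × ({j // j ∈ JB} → 𝕜) :=
    LinearMap.prod (LinearMap.pi fun i : {i // i ∉ IA} => innerₛₗ 𝕜 (hA.eigenvectorBasis i.1))
      (LinearMap.pi fun j : {j // j ∈ JB} => innerₛₗ 𝕜 (hB.eigenvectorBasis j.1))
  have hdim : Module.finrank 𝕜 (({i // i ∉ IA} → 𝕜) × ({j // j ∈ JB} → 𝕜)) <
      Module.finrank 𝕜 (EuclideanSpace 𝕜 n) := by
    have h1 : IA.card ≤ Fintype.card n := Finset.card_le_univ _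
    simp only [Module.finrank_prod, Module.finrank_fintype_fun_eq_card, finrank_euclideanSpace,
      Fintype.card_subtype_compl, Fintype.card_coe]
    omega
  obtain ⟨x, hxker, hx0⟩ := (Submodule.ne_bot_iff _).1 (LinearMap.ker_ne_bot_of_finrank_lt hdim (f := Φ))
  rw [LinearMap.mem_ker] at hxker
  have hxA : ∀ i, i ∉ IA → ⟪hA.eigenvectorBasis i, x⟫_𝕜 = 0 := fun i hi => by
    have := congrFun (congrArg Prod.fst hxker) ⟨i, hi⟩
    simpa [Φ, innerₛₗ_apply_apply] using this
  have hxB : ∀ j, j ∈ JB → ⟪hB.eigenvectorBasis j, x⟫_𝕜 = 0 := fun j hj => by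
    have := congrFun (congrArg Prod.snd hxker) ⟨j, hj⟩
    simpa [Φ, innerₛₗ_apply_apply] using this
  -- `IA` is nonempty, so the window is non-degenerate
  have hIAne : IA.Nonempty := by
    rw [Finset.nonempty_iff_ne_empty]
    intro h
    rw [h, Finset.card_empty] at hlt
    exact Nat.not_lt_zero _ hlt
  set c := (a + b) / 2 with hc
  set ρ := (b - a) / 2 with hρ
  obtain ⟨i₀, hi₀, hmax⟩ := Finset.exists_max_image IA (fun i => |hA.eigenvalues i - c|) hIAne
  set ρ' := |hA.eigenvalues i₀ - c| with hρ'
  have hρ'lt : ρ' + δ < ρ := by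
    have h := (Finset.mem_filter.1 hi₀).2
    rw [hρ', hρ, hc]
    rcases le_or_gt 0 (hA.eigenvalues i₀ - (a + b) / 2) with h' | h'
    · rw [abs_of_nonneg h']; linarith [h.2]
    · rw [abs_of_neg h']; linarith [h.1]
  have hρpos : 0 < ρ := by linarith [abs_nonneg (hA.eigenvalues i₀ - c)]
  -- upper bound for `A`
  have hupA : ‖toEuclideanLin A x - (c : 𝕜) • x‖ ≤ ρ' * ‖x‖ := by
    refine coareaPt_norm_le_mul hA c x (abs_nonneg _) fun k hk => ?_
    have hkI : k ∈ IA := by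
      by_contra hkI
      exact hk (hxA k hkI)
    exact hmax k hkI
  -- lower bound for `B`
  have hloB : ρ * ‖x‖ ≤ ‖toEuclideanLin B x - (c : 𝕜) • x‖ := by
    refine coareaPt_mul_norm_le hB c x hρpos.le fun k hk => ?_
    have hkJ : k ∉ JB := fun hkJ => hk (hxB k hkJ)
    rw [hJB, Finset.mem_filter, not_and_or] at hkJ
    rcases hkJ with h | h
    · exact absurd (Finset.mem_univ k) h
    · rw [hρ, hc]
      rcases le_or_gt 0 (hB.eigenvalues k - (a + b) / 2) with h' | h'
      · rw [abs_of_nonneg h']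
        by_contra hcon
        push Not at hcon
        exact h ⟨by linarith, by linarith⟩
      · rw [abs_of_neg h']
        by_contra hcon
        push Not at hcon
        exact h ⟨by linarith, by linarith⟩
  -- triangle inequality
  have htri : ‖toEuclideanLin B x - (c : 𝕜) • x‖ ≤
      ‖toEuclideanLin A x - (c : 𝕜) • x‖ + ‖toEuclideanLin B x - toEuclideanLin A x‖ := by
    have : toEuclideanLin B x - (c : 𝕜) • x =
        (toEuclideanLin A x - (c : 𝕜) • x) + (toEuclideanLin B x - toEuclideanLin A x) := by abel
    rw [this]
    exact norm_add_le _ _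
  have hxpos : 0 < ‖x‖ := norm_pos_iff.2 hx0
  have := hAB x
  nlinarith

section Family

variable {H : ℝ → Matrix n n 𝕜} (hH : ∀ t, (H t).IsHermitian)
  (hLip : ∀ (t t' : ℝ) (x : EuclideanSpace 𝕜 n),
    ‖toEuclideanLin (H t') x - toEuclideanLin (H t) x‖ ≤ |t' - t| * ‖x‖)
include hH hLip

/-- **Zero modes persist in the window**: if `H(t₀)` has `g` zero eigenvalues then `H(t)` has at
least `g` eigenvalues in `(-ε, ε)` whenever `|t - t₀| < ε` (the branches are `1`-Lipschitz). -/
theorem coareaPt_card_zero_le (t₀ t ε : ℝ) (ht : |t - t₀| < ε) :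
    (Finset.univ.filter fun i => (hH t₀).eigenvalues i = 0).card ≤
      (Finset.univ.filter fun i => |(hH t).eigenvalues i| < ε).card := by
  calc (Finset.univ.filter fun i => (hH t₀).eigenvalues i = 0).card
      ≤ (Finset.univ.filter fun i => -ε + |t - t₀| < (hH t₀).eigenvalues i ∧
          (hH t₀).eigenvalues i < ε - |t - t₀|).card := by
        refine Finset.card_le_card fun i hi => ?_
        simp only [Finset.mem_filter, Finset.mem_univ, true_and] at hi ⊢
        rw [hi]
        constructor <;> linarith
    _ ≤ (Finset.univ.filter fun j => -ε < (hH t).eigenvalues j ∧ (hH t).eigenvalues j < ε).card :=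
        coareaPt_card_window_le (hH t₀) (hH t) (abs_nonneg _) (-ε) ε (hLip t₀ t)
    _ ≤ (Finset.univ.filter fun i => |(hH t).eigenvalues i| < ε).card := by
        refine Finset.card_le_card fun i hi => ?_
        simp only [Finset.mem_filter, Finset.mem_univ, true_and] at hi ⊢
        exact abs_lt.2 hi

/-- **Lower semicontinuity of the window count** `t ↦ #{i | |λ_i(H t)| < ε}`. -/
theorem coareaPt_eventually_card_le (t₀ ε : ℝ) :
    ∀ᶠ t in 𝓝 t₀, (Finset.univ.filter fun i => |(hH t₀).eigenvalues i| < ε).card ≤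
      (Finset.univ.filter fun i => |(hH t).eigenvalues i| < ε).card := by
  set S := Finset.univ.filter fun i => |(hH t₀).eigenvalues i| < ε with hS
  by_cases hne : S.Nonempty
  · obtain ⟨i₀, hi₀, hmax⟩ := Finset.exists_max_image S (fun i => |(hH t₀).eigenvalues i|) hne
    have hM : |(hH t₀).eigenvalues i₀| < ε := (Finset.mem_filter.1 hi₀).2
    have hδ₀ : 0 < ε - |(hH t₀).eigenvalues i₀| := sub_pos.2 hM
    filter_upwards [Metric.ball_mem_nhds t₀ hδ₀] with t ht
    rw [Metric.mem_ball, Real.dist_eq] at ht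
    calc S.card ≤ (Finset.univ.filter fun i => -ε + |t - t₀| < (hH t₀).eigenvalues i ∧
            (hH t₀).eigenvalues i < ε - |t - t₀|).card := by
          refine Finset.card_le_card fun i hi => ?_
          have hle := hmax i hi
          simp only [Finset.mem_filter, Finset.mem_univ, true_and]
          have h1 : |(hH t₀).eigenvalues i| < ε - |t - t₀| := by linarith
          constructor <;> cases abs_lt.1 h1 <;> linarith
      _ ≤ (Finset.univ.filter fun j => -ε < (hH t).eigenvalues j ∧ (hH t).eigenvalues j < ε).card :=
          coareaPt_card_window_le (hH t₀) (hH t) (abs_nonneg _) (-ε) ε (hLip t₀ t)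
      _ ≤ (Finset.univ.filter fun i => |(hH t).eigenvalues i| < ε).card := by
          refine Finset.card_le_card fun i hi => ?_
          simp only [Finset.mem_filter, Finset.mem_univ, true_and] at hi ⊢
          exact abs_lt.2 hi
  · rw [Finset.not_nonempty_iff_eq_empty] at hne
    refine Eventually.of_forall fun t => ?_
    rw [hne, Finset.card_empty]
    exact Nat.zero_le _

/-- The window count `t ↦ #{i | |λ_i(H t)| < ε}` (as a real number) is Borel measurable. -/
theorem coareaPt_measurable_card (ε : ℝ) :
    Measurable fun t => (((Finset.univ.filter fun i => |(hH t).eigenvalues i| < ε).card : ℕ) : ℝ) := by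
  refine LowerSemicontinuous.measurable fun t₀ y hy => ?_
  filter_upwards [coareaPt_eventually_card_le hH hLip t₀ ε] with t ht
  exact hy.trans_le (by exact_mod_cast ht)

/-- **Few small eigenvalues near a crossing**: if the non-zero eigenvalues of `H(t₀)` have modulus
`≥ γ`, then for `|t - t₀| < γ/2` at most `#{i | λ_i(H t₀) = 0}` eigenvalues of `H(t)` have modulus
`< γ/2`. -/
theorem coareaPt_card_small_le (t₀ : ℝ) {γ : ℝ}
    (hgap : ∀ i, (hH t₀).eigenvalues i ≠ 0 → γ ≤ |(hH t₀).eigenvalues i|) (t : ℝ)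
    (ht : |t - t₀| < γ / 2) :
    (Finset.univ.filter fun i => |(hH t).eigenvalues i| < γ / 2).card ≤
      (Finset.univ.filter fun i => (hH t₀).eigenvalues i = 0).card := by
  have ht' : |t₀ - t| < γ / 2 := by rwa [abs_sub_comm]
  calc (Finset.univ.filter fun i => |(hH t).eigenvalues i| < γ / 2).card
      ≤ (Finset.univ.filter fun i => -γ + |t₀ - t| < (hH t).eigenvalues i ∧
          (hH t).eigenvalues i < γ - |t₀ - t|).card := by
        refine Finset.card_le_card fun i hi => ?_
        simp only [Finset.mem_filter, Finset.mem_univ, true_and] at hi ⊢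
        constructor <;> cases abs_lt.1 hi <;> linarith
    _ ≤ (Finset.univ.filter fun j => -γ < (hH t₀).eigenvalues j ∧ (hH t₀).eigenvalues j < γ).card :=
        coareaPt_card_window_le (hH t) (hH t₀) (abs_nonneg _) (-γ) γ (hLip t t₀)
    _ ≤ (Finset.univ.filter fun i => (hH t₀).eigenvalues i = 0).card := by
        refine Finset.card_le_card fun i hi => ?_
        simp only [Finset.mem_filter, Finset.mem_univ, true_and] at hi ⊢
        by_contra h0
        have := hgap i h0
        have h2 : |(hH t₀).eigenvalues i| < γ := abs_lt.2 hi
        linarith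

omit hH hLip in
/-- **Determinant lower bound**: if every eigenvalue of a Hermitian `A` has modulus `≥ ε`
(`0 < ε ≤ 1`) and at most `g` of them have modulus `< γ'`, then `ε^g (min 1 γ')^n ≤ |det A|`. -/
theorem coareaPt_det_lower {A : Matrix n n 𝕜} (hA : A.IsHermitian) {ε γ' : ℝ} {g : ℕ}
    (hε : 0 < ε) (hε1 : ε ≤ 1) (hγ' : 0 < γ')
    (hall : ∀ i, ε ≤ |hA.eigenvalues i|)
    (hfew : (Finset.univ.filter fun i => |hA.eigenvalues i| < γ').card ≤ g) :
    ε ^ g * (min 1 γ') ^ Fintype.card n ≤ ‖A.det‖ := by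
  rw [hA.det_eq_prod_eigenvalues, norm_prod]
  simp_rw [RCLike.norm_ofReal]
  rw [← Finset.prod_filter_mul_prod_filter_not Finset.univ (fun i => |hA.eigenvalues i| < γ')]
  have hm0 : 0 ≤ min 1 γ' := le_min zero_le_one hγ'.le
  refine mul_le_mul ?_ ?_ (pow_nonneg hm0 _) (Finset.prod_nonneg fun i _ => abs_nonneg _)
  · calc ε ^ g ≤ ε ^ (Finset.univ.filter fun i => |hA.eigenvalues i| < γ').card :=
          pow_le_pow_of_le_one hε.le hε1 hfew
      _ = ∏ _i ∈ Finset.univ.filter (fun i => |hA.eigenvalues i| < γ'), ε := by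
          rw [Finset.prod_const]
      _ ≤ _ := Finset.prod_le_prod (fun _ _ => hε.le) fun i _ => hall i
  · calc (min 1 γ') ^ Fintype.card n
        ≤ (min 1 γ') ^ (Finset.univ.filter fun i => ¬ |hA.eigenvalues i| < γ').card :=
          pow_le_pow_of_le_one hm0 (min_le_left _ _) (Finset.card_le_univ _)
      _ = ∏ _i ∈ Finset.univ.filter (fun i => ¬ |hA.eigenvalues i| < γ'), min 1 γ' := by
          rw [Finset.prod_const]
      _ ≤ _ := Finset.prod_le_prod (fun _ _ => hm0) fun i hi =>
          (min_le_right _ _).trans (not_lt.1 (Finset.mem_filter.1 hi).2)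

/-- **The window around one real eigenvalue.** Let `t₀` be a crossing with `g = #{λ_i(H t₀) = 0} ≤ k`,
`1 ≤ k`, and `|det H(t)| ≤ C|t - t₀|^k` near `t₀`. Then for all small `ε > 0` there are `c ∈ ℕ` and a
half-width `0 < w ≤ kε` with `c·w = kε` such that `H(t)` has at least `c` eigenvalues in `(-ε, ε)` for
`|t - t₀| < w` (`c = k, w = ε` if `g = k`; `c = 1, w = kε` if `g < k`). -/
theorem coareaPt_root_window (t₀ : ℝ) {k : ℕ} (hk : 1 ≤ k)
    (hgk : (Finset.univ.filter fun i => (hH t₀).eigenvalues i = 0).card ≤ k)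
    (hdet : ∃ C : ℝ, ∀ t : ℝ, |t - t₀| ≤ 1 → ‖(H t).det‖ ≤ C * |t - t₀| ^ k) :
    ∀ᶠ ε in 𝓝[>] (0 : ℝ), ∃ (c : ℕ) (w : ℝ), 0 < w ∧ w ≤ k * ε ∧ (c : ℝ) * w = k * ε ∧
      ∀ t, |t - t₀| < w → c ≤ (Finset.univ.filter fun i => |(hH t).eigenvalues i| < ε).card := by
  set g := (Finset.univ.filter fun i => (hH t₀).eigenvalues i = 0).card with hg
  have hk0 : (0 : ℝ) < k := by exact_mod_cast hk
  rcases hgk.eq_or_lt with hgk' | hgk'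
  · -- semisimple crossing: `g = k` zero modes, each within `ε` of zero for `|t - t₀| < ε`
    filter_upwards [self_mem_nhdsWithin] with ε hε
    change 0 < ε at hε
    refine ⟨k, ε, hε, le_mul_of_one_le_left hε.le (by exact_mod_cast hk), rfl, fun t ht => ?_⟩
    rw [← hgk', hg]
    exact coareaPt_card_zero_le hH hLip t₀ t ε ht
  · -- defective crossing: the determinant forces one eigenvalue below `ε` on a window `kε ≫ ε`
    obtain ⟨C, hC⟩ := hdet
    set C' := max C 1 with hC'
    have hC'pos : 0 < C' := lt_of_lt_of_le one_pos (le_max_right _ _)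
    have hC'b : ∀ t, |t - t₀| ≤ 1 → ‖(H t).det‖ ≤ C' * |t - t₀| ^ k := fun t ht =>
      (hC t ht).trans (mul_le_mul_of_nonneg_right (le_max_left _ _) (pow_nonneg (abs_nonneg _) _))
    -- spectral gap of `H t₀` away from its kernel
    obtain ⟨γ, hγ, hgap⟩ : ∃ γ : ℝ, 0 < γ ∧ ∀ i, (hH t₀).eigenvalues i ≠ 0 →
        γ ≤ |(hH t₀).eigenvalues i| := by
      by_cases hne : (Finset.univ.filter fun i => (hH t₀).eigenvalues i ≠ 0).Nonempty
      · obtain ⟨i₀, hi₀, hmin⟩ :=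
          Finset.exists_min_image _ (fun i => |(hH t₀).eigenvalues i|) hne
        refine ⟨|(hH t₀).eigenvalues i₀|, abs_pos.2 (Finset.mem_filter.1 hi₀).2, fun i hi => hmin i ?_⟩
        exact Finset.mem_filter.2 ⟨Finset.mem_univ _, hi⟩
      · exact ⟨1, one_pos, fun i hi => absurd ⟨i, Finset.mem_filter.2 ⟨Finset.mem_univ _, hi⟩⟩ hne⟩
    set G := (min 1 (γ / 2)) ^ Fintype.card n with hG
    have hGpos : 0 < G := pow_pos (lt_min one_pos (half_pos hγ)) _
    have hkk : (0 : ℝ) < C' * (k : ℝ) ^ k := mul_pos hC'pos (pow_pos hk0 _)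
    filter_upwards [Ioo_mem_nhdsGT (show (0 : ℝ) < 1 / k from by positivity),
      Ioo_mem_nhdsGT (show (0 : ℝ) < γ / 2 / k from by positivity),
      Ioo_mem_nhdsGT (show (0 : ℝ) < G / (C' * (k : ℝ) ^ k) from by positivity)] with ε h1 h2 h3
    obtain ⟨hε, h1⟩ := h1
    have hkε1 : (k : ℝ) * ε < 1 := by rwa [lt_div_iff₀ hk0, mul_comm] at h1
    have hkε2 : (k : ℝ) * ε < γ / 2 := by
      have := h2.2; rwa [lt_div_iff₀ hk0, mul_comm] at this
    have hε3 : ε * (C' * (k : ℝ) ^ k) < G := by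
      have := h3.2; rwa [lt_div_iff₀ hkk] at this
    have hk1 : (1 : ℝ) ≤ k := by exact_mod_cast hk
    have hε1 : ε ≤ 1 := ((le_mul_of_one_le_left hε.le hk1).trans hkε1.le)
    refine ⟨1, k * ε, by positivity, le_rfl, by push_cast; ring, fun t ht => ?_⟩
    by_contra hN
    push Not at hN
    have hN0 : (Finset.univ.filter fun i => |(hH t).eigenvalues i| < ε) = ∅ :=
      Finset.card_eq_zero.1 (Nat.lt_one_iff.1 hN)
    have hall : ∀ i, ε ≤ |(hH t).eigenvalues i| := fun i =>
      not_lt.1 (Finset.filter_eq_empty_iff.1 hN0 (Finset.mem_univ i))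
    have hfew := coareaPt_card_small_le hH hLip t₀ hgap t (ht.trans hkε2)
    have hlow := coareaPt_det_lower (hH t) hε hε1 (half_pos hγ) hall hfew
    have hup := hC'b t (ht.trans hkε1).le
    have hpow : |t - t₀| ^ k < ((k : ℝ) * ε) ^ k :=
      pow_lt_pow_left₀ ht (abs_nonneg _) (by omega)
    have hεpow : ε ^ (k - g) ≤ ε := pow_le_of_le_one hε.le hε1 (by omega)
    have key : ε ^ g * G < ε ^ g * (ε * (C' * (k : ℝ) ^ k)) :=
      calc ε ^ g * G ≤ ‖(H t).det‖ := hlow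
        _ ≤ C' * |t - t₀| ^ k := hup
        _ < C' * ((k : ℝ) * ε) ^ k := mul_lt_mul_of_pos_left hpow hC'pos
        _ = C' * (k : ℝ) ^ k * (ε ^ (k - g) * ε ^ g) := by
            rw [mul_pow, ← pow_add, Nat.sub_add_cancel hgk'.le]; ring
        _ ≤ C' * (k : ℝ) ^ k * (ε * ε ^ g) := by gcongr
        _ = ε ^ g * (ε * (C' * (k : ℝ) ^ k)) := by ring
    have := lt_of_mul_lt_mul_left key (pow_nonneg hε.le g)
    linarith

end Family

/-- From a right-neighbourhood statement at `0` to an explicit threshold. -/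
theorem coareaPt_exists_of_eventually {P : ℝ → Prop} (h : ∀ᶠ ε in 𝓝[>] (0 : ℝ), P ε) :
    ∃ ε₀ : ℝ, 0 < ε₀ ∧ ∀ ε : ℝ, 0 < ε → ε < ε₀ → P ε := by
  obtain ⟨ε₀, hε₀, hsub⟩ := mem_nhdsGT_iff_exists_Ioo_subset.1 h
  exact ⟨ε₀, hε₀, fun ε hε hεε₀ => hsub ⟨hε, hεε₀⟩⟩

/-- **Registered sub-goal `stub_coareaHermitianWindow`** (the output of this file, consumed by the
proof of `stub_coareaPointwise`): for a `1`-Lipschitz Hermitian family `H : ℝ → Matrix n n ℂ`,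
(i) the window count `t ↦ #{i | |λ_i(H t)| < ε}` is Borel measurable, and (ii) around a crossing `t₀`
with `#{λ_i(H t₀) = 0} ≤ k`, `1 ≤ k` and `|det H(t)| ≤ C|t − t₀|^k` for `|t − t₀| ≤ 1`, for all small
`ε > 0` there are `c ∈ ℕ` and `0 < w ≤ kε` with `c·w = kε` such that `H(t)` has at least `c` eigenvalues
in `(−ε, ε)` whenever `|t − t₀| < w`. -/
theorem stub_coareaHermitianWindow :
    ∀ (n : Type) [Fintype n] [DecidableEq n] (H : ℝ → Matrix n n ℂ) (hH : ∀ t : ℝ, (H t).IsHermitian),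
      (∀ (t t' : ℝ) (x : EuclideanSpace ℂ n), ‖Matrix.toEuclideanLin (H t') x -
      Matrix.toEuclideanLin (H t) x‖ ≤ |t' - t| * ‖x‖) → (∀ ε : ℝ, Measurable fun t : ℝ =>
      (((Finset.univ.filter fun i : n => |(hH t).eigenvalues i| < ε).card : ℕ) : ℝ)) ∧ (∀ (t₀ : ℝ)
      (k : ℕ), 1 ≤ k → (Finset.univ.filter fun i : n => (hH t₀).eigenvalues i = 0).card ≤ k → (∃ C :
      ℝ, ∀ t : ℝ, |t - t₀| ≤ 1 → ‖(H t).det‖ ≤ C * |t - t₀| ^ k) → ∃ ε₁ : ℝ, 0 < ε₁ ∧ ∀ ε : ℝ, 0 <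
      ε → ε < ε₁ → ∃ (c : ℕ) (w : ℝ), 0 < w ∧ w ≤ k * ε ∧ (c : ℝ) * w = k * ε ∧ ∀ t : ℝ, |t - t₀| <
      w → c ≤ (Finset.univ.filter fun i : n => |(hH t).eigenvalues i| < ε).card) := by
  intro n _ _ H hH hLip
  exact ⟨coareaPt_measurable_card hH hLip, fun t₀ k hk hgk hdet =>
    coareaPt_exists_of_eventually (coareaPt_root_window hH hLip t₀ hk hgk hdet)⟩

end Summit.QuantumFields.QCD.Cruxes.TipPricing.HermitianFlowCoarea

end
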